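import Mathlib.Analysis.Matrix.Normed                        -- `open scoped Matrix.Norms.Operator` (the cell's normed structure on `M₃(ℂ)`, as in ★ (A1)∕(A2′)∕the letter)
import Mathlib.Analysis.Calculus.ContDiff.Basic
import Mathlib.Analysis.Normed.Operator.BoundedLinearMaps   -- `isBoundedBilinearMap_apply` (joint continuity of evaluation)
import Literature.Geometry.ComplexHyperbolic.UnitBallSheetIntegralDeriv   -- ★ the Θ-free `C²` engine (parts 1 + 2)
import HarnessLib

/-!
# The `ε²`-normalised `K`-central orbital integrals of `U(2,1)` are `C²` down to the centre, with cone-integral coefficients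
# (ROAD A (A3-c′): the engine ★ `UnitBallSheetIntegralDeriv` instantiated at `Λ(W, r) = Θ(u•1 − η•N(W₀, W₁, r))`)

Topic `Geometry/ComplexHyperbolic`; namespace `Literature.Geometry.ComplexHyperbolic.BallModel`.  THEOREMS ONLY (no `def`, no instance, no notation,
no axiom, no named fact, no `sorry`).  Cell `pub/hodgecm-mathlib`, ENGINE T1 (crux H413 = `stmt-HodgeConjecture-24833`); floor-1½ preparation, count-neutral,
under row (S-d) ∕ «SdArch» ED. 3 node N1 = the (L_{U(2,1)}) letter ★ `ArchCentralLimitFormulaRankTwo` (`stub_ArchCentralLimitU21`): brick **ROAD A (A3-c′)** (A-p14 (g28) cost census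
e5e8455f §3 + (A2″); p02 (g12) (α1) skeleton; LEAD F0P3a-plan (g10) WORDS T9-1 (4), T9-8; author F0P3a-p05 (g13)).  Continues ★ `UnitBallHyperboloidChart`, ★ `UnitBallKCentralConeLimit`,
★ `UnitBallSheetIntegralBounds`, ★ `UnitBallSheetIntegralDeriv`.  Matrix norms: `open scoped Matrix.Norms.Operator` as in ★ `ArchCompactWallTransversalExpansion` and the letter.

THE MATHEMATICS.  For `Θ : M₃(ℂ) → G` and `u, η ∈ ℂ` put `h(W, r) := u•1 − η•N(W₀, W₁, r)` (`r ∈ ℝ`, `N(x) = x x* J`).  (1) `N` IS A REAL QUADRATIC POLYNOMIAL IN THE SHEET COORDINATE: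
`N(W₀,W₁,r) = A₀(W) + r•A₁(W) + r²•A₂`, `A₀ = a a* J`, `A₁ = (a e₂* + e₂ a*) J`, `A₂ = e₂ e₂* J`, `a = (W₀, W₁, 0)`, `e₂ = (0,0,1)`; so with `v(W,r) := ∂_r h = −η•(A₁(W) + 2r•A₂)` and
`v′ := ∂_r v = −η•2A₂`, for `Θ ∈ C¹` resp. `C²` (chain rule, `HasDerivAt.clm_apply`):
  `∂_r Θ(h) = DΘ(h)[v]`,   `∂_r DΘ(h)[v] = D²Θ(h)[v, v] + DΘ(h)[v′]`,
all three jointly continuous in `(W, r)` (`ContDiff.continuous_fderiv_apply`), and (2) for `Θ` with compact support and `η ≠ 0` the datum has the `r²`-SUPPORT BOUND `Θ(h(W,r)) = 0` for `r² ≥ R∕|η|`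
(the `(2,2)` entry of `−η•N` is `η r²`; ★ `exists_radius_apply_add_eq_zero`).  Hence the engine applies and gives, for `I_Θ(ε) := ∫_{ℂ²} Θ(h(W, √(ε+|W|²))) d⁴W`
(`= ε²∕9 · ∫_{𝔹²} Θ(u•1 + (εη)•P(lift z)) dβ` for `ε > 0`, ★ `sq_smul_integral_bergmanVolume_pencil_eq_chart`), with `ρ = √(ε+|W|²)`:
  **`I_Θ ∈ C²([0,∞))`: `I_Θ′(ε) = I₁(ε) := ∫ (2ρ)⁻¹•DΘ(h)[v] d⁴W`, `I₁′(ε) = I₂(ε) := ∫ [(4ρ²)⁻¹•(D²Θ(h)[v,v] + DΘ(h)[v′]) − (4ρ³)⁻¹•DΘ(h)[v]] d⁴W` for `ε > 0`;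
  `I_Θ, I₁, I₂` continuous on `[0,∞)`; right-derivatives `I₁(0)`, `I₂(0)` at the CENTRE `ε = 0`, where `h = u•1 − η•N(W,|W|)` runs over the translated NULL CONE;**
and **`d∕dε [ε² · ∫_{𝔹²} Θ(u•1 + (εη)•P(lift z)) dβ] = 9·I₁(ε)`** (`ε > 0`).  So `ε²Φ(k_ε, Θ) = 9[I_Θ(0) + I₁(0)ε + ½I₂(0)ε²] + o(ε²)`: the second-order expansion of the normalised
`K`-central orbital integrals of `U(2,1)` at the centre, each coefficient an absolutely convergent integral over the null cone of `Θ`, `DΘ`, `D²Θ` against explicit polynomial weights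
(the asymptotic-cone ∕ nilpotent-germ picture [Varadarajan1989 §6.4], made quantitative to order 2).  This is the (A3) input of the (A4) VALUE computation along the compact wall; by the centre's
equivariance `F_Θ(ζz) = F_{Θ(ζ·)}(z)` the tangential wall derivatives are the same heads applied to `Θ ∘ (e^{iθ}·)`, and (A2″)'s transversal term `N²Φ` is the engine at another datum.
GOTCHA recorded for successors: under `open scoped Matrix.Norms.Operator` do NOT ascribe `ContDiff ℝ 1 (fderiv ℝ Θ)` by hand (`fderiv` takes a bare `[TopologicalSpace E]`, picks the Pi topology
on `Matrix`, and `NormedAddCommGroup (M₃(ℂ) →L[ℝ] G)` is then unsynthesisable); take `hΘ.fderiv_right` unascribed and use `ContDiff.continuous_fderiv_apply` ∕ `isBoundedBilinearMap_apply`.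

* §1 `vecMulVec_vecCons_real_mul_J_eq` (the polynomial structure), `hasDerivAt_sheet_arg` (`∂_r h = v`), `hasDerivAt_sheet_arg_deriv` (`∂_r v = v′`);
* §2 `continuous_sheet_arg`, `continuous_sheet_dir`, **`hasDerivAt_comp_sheet_arg`** (`C¹`), **`hasDerivAt_fderiv_comp_sheet_arg`** (`C²`), **`exists_sq_support_bound_sheet`**;
* §3 `continuous_sheet_datum_two`, **`hasDerivAt_integral_kCentral_sheet`**, **`hasDerivAt_integral_kCentral_sheet_deriv`**, **`continuousOn_integral_kCentral_sheet_zero∕one∕two`**,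
  **`hasDerivWithinAt_integral_kCentral_sheet_zero∕one`**, **`hasDerivAt_sq_smul_integral_bergmanVolume_pencil`**.
HONEST LABEL: HC_CM is proved only modulo the printed citations until rung 0 closes; this file is real analysis over ★ ball-model files and pays nothing by itself.

## References
* [Rogawski1990] J. D. Rogawski, *Automorphic Representations of Unitary Groups in Three Variables*, Ann. of Math. Stud. 123 (1990), §8.4 pp. 126–127 (normalised singular orbital integrals at the
  compact wall of `U(2,1)`, differentiated on the way to the central limit formula).
* [Varadarajan1989] V. S. Varadarajan, *An Introduction to Harmonic Analysis on Semisimple Lie Groups* (1989), §6.4 (derivatives of `F_f` at singular points; nilpotent cones as asymptotic cones).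
* [Goldman1999] W. M. Goldman, *Complex Hyperbolic Geometry* (1999), §3.1.1–3.1.2 (hyperboloid model; `N(x) = x x* J`).
* [Rudin1980] W. Rudin, *Function Theory in the Unit Ball of ℂⁿ* (1980), §1.4, §2.2.
-/

noncomputable section

open MeasureTheory MeasureTheory.Measure Set Filter Topology Metric Matrix
open scoped ENNReal Matrix.Norms.Operator

namespace Literature.Geometry.ComplexHyperbolic.BallModel

/-! ### §1 The sheet point with a real last coordinate: `N(W, r) = A₀(W) + r•A₁(W) + r²•A₂` -/

/-- **POLYNOMIAL STRUCTURE OF `N` ALONG THE SHEET COORDINATE**: for `x = (W₀, W₁, r)` with `r` REAL,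
`N(x) = x x* J = A₀(W) + r•A₁(W) + r²•A₂` with `A₀ = a a* J`, `A₁ = (a e₂* + e₂ a*) J`, `A₂ = e₂ e₂* J`, `a = (W₀, W₁, 0)`, `e₂ = (0,0,1)`.
[cite: Goldman1999, §3.1.1] -/
theorem vecMulVec_vecCons_real_mul_J_eq (W : Fin 2 → ℂ) (r : ℝ) :
    vecMulVec ![W 0, W 1, (r : ℂ)] (star ![W 0, W 1, (r : ℂ)]) * J =
      vecMulVec ![W 0, W 1, 0] (star ![W 0, W 1, 0]) * J +
        r • ((vecMulVec ![W 0, W 1, 0] (star ![(0 : ℂ), 0, 1]) + vecMulVec ![(0 : ℂ), 0, 1] (star ![W 0, W 1, 0])) * J) +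
        r ^ 2 • (vecMulVec ![(0 : ℂ), 0, 1] (star ![(0 : ℂ), 0, 1]) * J) := by
  ext i j
  simp only [J, Matrix.mul_diagonal, Matrix.add_apply, Matrix.smul_apply, Matrix.add_mul, vecMulVec_apply, Pi.star_apply, Complex.star_def,
    Complex.real_smul]
  fin_cases i <;> fin_cases j <;> simp [Complex.conj_ofReal] <;> ring

/-- The affine sheet argument `h(W, r) = u•1 − η•N(W₀, W₁, r)` has `r`-derivative `−η•(A₁(W) + (2r)•A₂)`. [cite: Goldman1999, §3.1.1] -/
theorem hasDerivAt_sheet_arg (u η : ℂ) (W : Fin 2 → ℂ) (r : ℝ) :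
    HasDerivAt (fun r : ℝ => u • (1 : Matrix (Fin 3) (Fin 3) ℂ) - η • (vecMulVec ![W 0, W 1, (r : ℂ)] (star ![W 0, W 1, (r : ℂ)]) * J))
      (-(η • ((vecMulVec ![W 0, W 1, 0] (star ![(0 : ℂ), 0, 1]) + vecMulVec ![(0 : ℂ), 0, 1] (star ![W 0, W 1, 0])) * J +
        (2 * r) • (vecMulVec ![(0 : ℂ), 0, 1] (star ![(0 : ℂ), 0, 1]) * J)))) r := by
  have h1 : HasDerivAt (fun r : ℝ => r • ((vecMulVec ![W 0, W 1, 0] (star ![(0 : ℂ), 0, 1]) + vecMulVec ![(0 : ℂ), 0, 1] (star ![W 0, W 1, 0])) * J))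
      ((1 : ℝ) • ((vecMulVec ![W 0, W 1, 0] (star ![(0 : ℂ), 0, 1]) + vecMulVec ![(0 : ℂ), 0, 1] (star ![W 0, W 1, 0])) * J)) r :=
    (hasDerivAt_id r).smul_const _
  have h2 : HasDerivAt (fun r : ℝ => r ^ 2 • (vecMulVec ![(0 : ℂ), 0, 1] (star ![(0 : ℂ), 0, 1]) * J))
      (((2 : ℕ) * r ^ (2 - 1)) • (vecMulVec ![(0 : ℂ), 0, 1] (star ![(0 : ℂ), 0, 1]) * J)) r :=
    (hasDerivAt_pow 2 r).smul_const _
  have h3 := ((h1.add h2).const_add (vecMulVec ![W 0, W 1, 0] (star ![W 0, W 1, 0]) * J)).const_smul η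
  have h4 := h3.const_sub (u • (1 : Matrix (Fin 3) (Fin 3) ℂ))
  have h5 : HasDerivAt (fun r : ℝ => u • (1 : Matrix (Fin 3) (Fin 3) ℂ) - η • (vecMulVec ![W 0, W 1, (r : ℂ)] (star ![W 0, W 1, (r : ℂ)]) * J))
      (-(η • ((1 : ℝ) • ((vecMulVec ![W 0, W 1, 0] (star ![(0 : ℂ), 0, 1]) + vecMulVec ![(0 : ℂ), 0, 1] (star ![W 0, W 1, 0])) * J) +
        ((2 : ℕ) * r ^ (2 - 1)) • (vecMulVec ![(0 : ℂ), 0, 1] (star ![(0 : ℂ), 0, 1]) * J)))) r := by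
    refine h4.congr_of_eventuallyEq (Filter.Eventually.of_forall fun r' => ?_)
    simp only [vecMulVec_vecCons_real_mul_J_eq, Pi.add_apply, Pi.smul_apply, smul_add, add_assoc]
  refine h5.congr_deriv ?_
  simp only [one_smul, Nat.cast_ofNat, pow_one, Nat.add_one_sub_one]

/-- The `r`-derivative `v(W,r) = −η•(A₁(W) + (2r)•A₂)` of the sheet argument has `r`-derivative `−η•(2•A₂)`. [cite: Goldman1999, §3.1.1] -/
theorem hasDerivAt_sheet_arg_deriv (η : ℂ) (W : Fin 2 → ℂ) (r : ℝ) :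
    HasDerivAt (fun r : ℝ => -(η • ((vecMulVec ![W 0, W 1, 0] (star ![(0 : ℂ), 0, 1]) + vecMulVec ![(0 : ℂ), 0, 1] (star ![W 0, W 1, 0])) * J +
        (2 * r) • (vecMulVec ![(0 : ℂ), 0, 1] (star ![(0 : ℂ), 0, 1]) * J))))
      (-(η • ((2 : ℝ) • (vecMulVec ![(0 : ℂ), 0, 1] (star ![(0 : ℂ), 0, 1]) * J)))) r := by
  have h1 : HasDerivAt (fun r : ℝ => (2 * r) • (vecMulVec ![(0 : ℂ), 0, 1] (star ![(0 : ℂ), 0, 1]) * J))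
      ((2 * 1 : ℝ) • (vecMulVec ![(0 : ℂ), 0, 1] (star ![(0 : ℂ), 0, 1]) * J)) r :=
    ((hasDerivAt_id r).const_mul 2).smul_const _
  have h2 := ((h1.const_add ((vecMulVec ![W 0, W 1, 0] (star ![(0 : ℂ), 0, 1]) + vecMulVec ![(0 : ℂ), 0, 1] (star ![W 0, W 1, 0])) * J)).const_smul η).neg
  refine h2.congr_deriv ?_
  rw [mul_one]

/-! ### §2 The `K`-central sheet datum `Λ(W, r) = Θ(u•1 − η•N(W₀, W₁, r))` satisfies the hypotheses of the engine -/

section Datum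

variable {G : Type*} [NormedAddCommGroup G] [NormedSpace ℝ G]

/-- The sheet argument `(W, r) ↦ u•1 − η•N(W₀, W₁, r)` is jointly continuous. [cite: Goldman1999, §3.1.1] -/
theorem continuous_sheet_arg (u η : ℂ) :
    Continuous fun p : (Fin 2 → ℂ) × ℝ => u • (1 : Matrix (Fin 3) (Fin 3) ℂ) -
      η • (vecMulVec ![p.1 0, p.1 1, (p.2 : ℂ)] (star ![p.1 0, p.1 1, (p.2 : ℂ)]) * J) := by
  have hx : Continuous fun p : (Fin 2 → ℂ) × ℝ => (![p.1 0, p.1 1, (p.2 : ℂ)] : Fin 3 → ℂ) :=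
    ((continuous_apply 0).comp continuous_fst).matrixVecCons (((continuous_apply 1).comp continuous_fst).matrixVecCons
      ((Complex.continuous_ofReal.comp continuous_snd).matrixVecCons continuous_const))
  exact continuous_const.sub ((continuous_vecMulVec_star_mul_J.comp hx).const_smul η)

/-- The `r`-derivative direction `(W, r) ↦ −η•(A₁(W) + (2r)•A₂)` is jointly continuous. [cite: Goldman1999, §3.1.1] -/
theorem continuous_sheet_dir (η : ℂ) :
    Continuous fun p : (Fin 2 → ℂ) × ℝ => -(η • ((vecMulVec ![p.1 0, p.1 1, 0] (star ![(0 : ℂ), 0, 1]) +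
        vecMulVec ![(0 : ℂ), 0, 1] (star ![p.1 0, p.1 1, 0])) * J + (2 * p.2) • (vecMulVec ![(0 : ℂ), 0, 1] (star ![(0 : ℂ), 0, 1]) * J))) := by
  have ha : Continuous fun p : (Fin 2 → ℂ) × ℝ => (![p.1 0, p.1 1, (0 : ℂ)] : Fin 3 → ℂ) :=
    ((continuous_apply 0).comp continuous_fst).matrixVecCons (((continuous_apply 1).comp continuous_fst).matrixVecCons continuous_const)
  have h1 : Continuous fun p : (Fin 2 → ℂ) × ℝ => vecMulVec ![p.1 0, p.1 1, (0 : ℂ)] (star ![(0 : ℂ), 0, 1]) :=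
    ha.matrix_vecMulVec continuous_const
  have h2 : Continuous fun p : (Fin 2 → ℂ) × ℝ => vecMulVec ![(0 : ℂ), 0, 1] (star ![p.1 0, p.1 1, (0 : ℂ)]) :=
    continuous_const.matrix_vecMulVec ha.star
  exact (((h1.add h2).mul continuous_const).add ((continuous_const.mul continuous_snd).smul continuous_const)).const_smul η |>.neg

/-- **THE DATUM IS DIFFERENTIABLE IN THE SHEET COORDINATE**: for `Θ` of class `C¹`,
`∂_r Θ(u•1 − η•N(W₀,W₁,r)) = DΘ(u•1 − η•N)[−η•(A₁(W) + (2r)•A₂)]`. [cite: Rogawski1990, §8.4 pp. 126–127] [cite: Goldman1999, §3.1.1] -/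
theorem hasDerivAt_comp_sheet_arg (Θ : Matrix (Fin 3) (Fin 3) ℂ → G) {n : WithTop ℕ∞} (hΘ : ContDiff ℝ n Θ) (hn : n ≠ 0) (u η : ℂ)
    (W : Fin 2 → ℂ) (r : ℝ) :
    HasDerivAt (fun r : ℝ => Θ (u • (1 : Matrix (Fin 3) (Fin 3) ℂ) - η • (vecMulVec ![W 0, W 1, (r : ℂ)] (star ![W 0, W 1, (r : ℂ)]) * J)))
      ((fderiv ℝ Θ (u • (1 : Matrix (Fin 3) (Fin 3) ℂ) - η • (vecMulVec ![W 0, W 1, (r : ℂ)] (star ![W 0, W 1, (r : ℂ)]) * J)))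
        (-(η • ((vecMulVec ![W 0, W 1, 0] (star ![(0 : ℂ), 0, 1]) + vecMulVec ![(0 : ℂ), 0, 1] (star ![W 0, W 1, 0])) * J +
          (2 * r) • (vecMulVec ![(0 : ℂ), 0, 1] (star ![(0 : ℂ), 0, 1]) * J))))) r :=
  ((hΘ.differentiable hn).differentiableAt.hasFDerivAt).comp_hasDerivAt r (hasDerivAt_sheet_arg u η W r)

/-- **… AND TWICE, for `Θ` of class `C²`**: `∂_r [DΘ(h)[v]] = D²Θ(h)[v, v] + DΘ(h)[−η•2A₂]` along the sheet coordinate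
(`h = u•1 − η•N(W₀,W₁,r)`, `v = ∂_r h`). [cite: Rogawski1990, §8.4 pp. 126–127] [cite: Goldman1999, §3.1.1] -/
theorem hasDerivAt_fderiv_comp_sheet_arg (Θ : Matrix (Fin 3) (Fin 3) ℂ → G) {n : WithTop ℕ∞} (hΘ : ContDiff ℝ n Θ) (hn : 2 ≤ n) (u η : ℂ)
    (W : Fin 2 → ℂ) (r : ℝ) :
    HasDerivAt (fun r : ℝ => (fderiv ℝ Θ (u • (1 : Matrix (Fin 3) (Fin 3) ℂ) - η • (vecMulVec ![W 0, W 1, (r : ℂ)] (star ![W 0, W 1, (r : ℂ)]) * J)))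
        (-(η • ((vecMulVec ![W 0, W 1, 0] (star ![(0 : ℂ), 0, 1]) + vecMulVec ![(0 : ℂ), 0, 1] (star ![W 0, W 1, 0])) * J +
          (2 * r) • (vecMulVec ![(0 : ℂ), 0, 1] (star ![(0 : ℂ), 0, 1]) * J)))))
      ((fderiv ℝ (fderiv ℝ Θ) (u • (1 : Matrix (Fin 3) (Fin 3) ℂ) - η • (vecMulVec ![W 0, W 1, (r : ℂ)] (star ![W 0, W 1, (r : ℂ)]) * J))
          (-(η • ((vecMulVec ![W 0, W 1, 0] (star ![(0 : ℂ), 0, 1]) + vecMulVec ![(0 : ℂ), 0, 1] (star ![W 0, W 1, 0])) * J +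
            (2 * r) • (vecMulVec ![(0 : ℂ), 0, 1] (star ![(0 : ℂ), 0, 1]) * J)))))
          (-(η • ((vecMulVec ![W 0, W 1, 0] (star ![(0 : ℂ), 0, 1]) + vecMulVec ![(0 : ℂ), 0, 1] (star ![W 0, W 1, 0])) * J +
            (2 * r) • (vecMulVec ![(0 : ℂ), 0, 1] (star ![(0 : ℂ), 0, 1]) * J)))) +
        (fderiv ℝ Θ (u • (1 : Matrix (Fin 3) (Fin 3) ℂ) - η • (vecMulVec ![W 0, W 1, (r : ℂ)] (star ![W 0, W 1, (r : ℂ)]) * J)))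
          (-(η • ((2 : ℝ) • (vecMulVec ![(0 : ℂ), 0, 1] (star ![(0 : ℂ), 0, 1]) * J))))) r := by
  -- NB: no type ascription on `h1` — `fderiv ℝ Θ` must keep the norm-derived topology on the space of continuous linear maps
  have h1 := hΘ.fderiv_right (m := 1) (le_trans (by norm_num) hn)
  have hc := ((h1.differentiable one_ne_zero).differentiableAt.hasFDerivAt).comp_hasDerivAt r (hasDerivAt_sheet_arg u η W r)
  exact hc.clm_apply (hasDerivAt_sheet_arg_deriv η W r)

/-- **THE `r²`-SUPPORT BOUND**: for `Θ` with compact support and `η ≠ 0` there is `S` with `Θ(u•1 − η•N(W₀,W₁,r)) = 0` whenever `r² ≥ S`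
(the `(2,2)` entry of `−η•N` is `η r²`; ★ `exists_radius_apply_add_eq_zero`). [cite: Rudin1980, §1.4] -/
theorem exists_sq_support_bound_sheet {G : Type*} [Zero G] [TopologicalSpace G] (Θ : Matrix (Fin 3) (Fin 3) ℂ → G) (hΘc : HasCompactSupport Θ)
    (u : ℂ) {η : ℂ} (hη : η ≠ 0) :
    ∃ S : ℝ, 0 < S ∧ ∀ (W : Fin 2 → ℂ) (r : ℝ), S ≤ r ^ 2 →
      Θ (u • (1 : Matrix (Fin 3) (Fin 3) ℂ) - η • (vecMulVec ![W 0, W 1, (r : ℂ)] (star ![W 0, W 1, (r : ℂ)]) * J)) = 0 := by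
  obtain ⟨R, hR, hRΘ⟩ := exists_radius_apply_add_eq_zero Θ hΘc u
  have hηpos : 0 < ‖η‖ := norm_pos_iff.2 hη
  refine ⟨R / ‖η‖, by positivity, fun W r hr => ?_⟩
  rw [sub_eq_add_neg, ← neg_smul]
  apply hRΘ
  rw [Matrix.smul_apply, smul_eq_mul, vecMulVec_star_mul_J_apply]
  simp only [cons_val, J, diagonal_apply_eq, Complex.conj_ofReal, mul_neg, mul_one, neg_mul, neg_neg, norm_mul, Complex.norm_real, Real.norm_eq_abs]
  rw [← abs_mul, ← sq, abs_of_nonneg (sq_nonneg r)]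
  rw [div_le_iff₀ hηpos] at hr
  nlinarith

end Datum

/-! ### §3 The `ε²`-normalised `K`-central orbital integrals in the chart are `C²` on `[0, ∞)`

For `Θ : M₃(ℂ) → G` of class `C²` with compact support, `u ∈ ℂ`, `η ≠ 0`, the sheet integral `I_Θ(ε) = ∫_{ℂ²} Θ(u•1 − η•N(W, √(ε+|W|²))) d⁴W`
(`= ε²∕9 · ∫_{𝔹²} Θ(u•1 + (εη)•P(lift z)) dβ` for `ε > 0`, ★ `sq_smul_integral_bergmanVolume_pencil_eq_chart`) and its two derivative integrals
`I₁ = ∫ (2ρ)⁻¹•DΘ(h)[v]`, `I₂ = ∫ [(4ρ²)⁻¹•(D²Θ(h)[v,v] + DΘ(h)[v′]) − (4ρ³)⁻¹•DΘ(h)[v]]` (`h = u•1 − η•N(W,ρ)`, `v = −η•(A₁(W) + 2ρ•A₂)`, `v′ = −η•2A₂`,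
`ρ = √(ε+|W|²)`) instantiate the Θ-free engine ★ `UnitBallSheetIntegralDeriv`. -/

section SecondOrder

variable {G : Type*} [NormedAddCommGroup G] [NormedSpace ℝ G]

/-- Joint continuity of the order-2 datum `(W, r) ↦ D²Θ(h)[v,v] + DΘ(h)[v′]` for `Θ` of class `C²`. [cite: Rogawski1990, §8.4 pp. 126–127] -/
theorem continuous_sheet_datum_two (Θ : Matrix (Fin 3) (Fin 3) ℂ → G) {n : WithTop ℕ∞} (hΘ : ContDiff ℝ n Θ) (hn : 2 ≤ n) (u η : ℂ) :
    Continuous (Function.uncurry fun (W : Fin 2 → ℂ) (r : ℝ) => ((fderiv ℝ (fderiv ℝ Θ) (u • (1 : Matrix (Fin 3) (Fin 3) ℂ) - η • (vecMulVec ![W 0, W 1, (r : ℂ)] (star ![W 0, W 1, (r : ℂ)]) * J)) (-(η • ((vecMulVec ![W 0, W 1, 0] (star ![(0 : ℂ), 0, 1]) + vecMulVec ![(0 : ℂ), 0, 1] (star ![W 0, W 1, 0])) * J + (2 * r) • (vecMulVec ![(0 : ℂ), 0, 1] (star ![(0 : ℂ), 0, 1]) * J))))) (-(η • ((vecMulVec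 ![W 0, W 1, 0] (star ![(0 : ℂ), 0, 1]) + vecMulVec ![(0 : ℂ), 0, 1] (star ![W 0, W 1, 0])) * J + (2 * r) • (vecMulVec ![(0 : ℂ), 0, 1] (star ![(0 : ℂ), 0, 1]) * J)))) + (fderiv ℝ Θ (u • (1 : Matrix (Fin 3) (Fin 3) ℂ) - η • (vecMulVec ![W 0, W 1, (r : ℂ)] (star ![W 0, W 1, (r : ℂ)]) * J))) (-(η • ((2 : ℝ) • (vecMulVec ![(0 : ℂ), 0, 1] (star ![(0 : ℂ), 0, 1]) * J)))))) := by
  have hn0 : n ≠ 0 := by intro h; rw [h] at hn; exact absurd hn (by norm_num)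
  -- NB: no type ascription — `fderiv ℝ Θ` must keep the norm-derived topology on the space of continuous linear maps
  have h1 := hΘ.fderiv_right (m := 1) (le_trans (by norm_num) hn)
  have hH : Continuous fun p : (Fin 2 → ℂ) × ℝ => (fun (W : Fin 2 → ℂ) (r : ℝ) => u • (1 : Matrix (Fin 3) (Fin 3) ℂ) - η • (vecMulVec ![W 0, W 1, (r : ℂ)] (star ![W 0, W 1, (r : ℂ)]) * J)) p.1 p.2 := continuous_sheet_arg u η
  have hV : Continuous fun p : (Fin 2 → ℂ) × ℝ => (fun (W : Fin 2 → ℂ) (r : ℝ) => -(η • ((vecMulVec ![W 0, W 1, 0] (star ![(0 : ℂ), 0, 1]) + vecMulVec ![(0 : ℂ), 0, 1] (star ![W 0, W 1, 0])) * J + (2 * r) • (vecMulVec ![(0 : ℂ), 0, 1] (star ![(0 : ℂ), 0, 1]) * J)))) p.1 p.2 := continuous_sheet_dir η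
  have cA := (h1.continuous_fderiv_apply one_ne_zero).comp (hH.prodMk hV)
  have cB := ((isBoundedBilinearMap_apply (𝕜 := ℝ) (E := Matrix (Fin 3) (Fin 3) ℂ) (F := G)).continuous).comp (cA.prodMk hV)
  have cC := (hΘ.continuous_fderiv_apply hn0).comp (hH.prodMk (continuous_const (y := (-(η • ((2 : ℝ) • (vecMulVec ![(0 : ℂ), 0, 1] (star ![(0 : ℂ), 0, 1]) * J))) : Matrix (Fin 3) (Fin 3) ℂ))))
  exact cB.add cC

/-- **`I_Θ` IS DIFFERENTIABLE FOR `ε > 0` WITH `I_Θ′ = I₁`** (★ `hasDerivAt_integral_sheet` instantiated; the order-1 integrand is integrable).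
[cite: Rogawski1990, §8.4 pp. 126–127] [cite: Rudin1980, §1.4] -/
theorem hasDerivAt_integral_kCentral_sheet (Θ : Matrix (Fin 3) (Fin 3) ℂ → G) {n : WithTop ℕ∞} (hΘ : ContDiff ℝ n Θ) (hn : n ≠ 0)
    (hΘc : HasCompactSupport Θ) (u : ℂ) {η : ℂ} (hη : η ≠ 0) {ε : ℝ} (hε : 0 < ε) :
    Integrable (fun W : Fin 2 → ℂ => (2 * Real.sqrt (ε + nsq W))⁻¹ • (fderiv ℝ Θ (u • (1 : Matrix (Fin 3) (Fin 3) ℂ) - η • (vecMulVec ![W 0, W 1, (Real.sqrt (ε + nsq W) : ℂ)] (star ![W 0, W 1, (Real.sqrt (ε + nsq W) : ℂ)]) * J))) (-(η • ((vecMulVec ![W 0, W 1, 0] (star ![(0 : ℂ), 0, 1]) + vecMulVec ![(0 : ℂ), 0, 1] (star ![W 0, W 1, 0])) * J + (2 * Real.sqrt (ε + nsq W)) • (vecMulVec ![(0 : ℂ), 0, 1] (star ![(0 : ℂ), 0, 1]) * J))))) ∧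
      HasDerivAt (fun ε : ℝ => ∫ W : Fin 2 → ℂ, Θ (u • (1 : Matrix (Fin 3) (Fin 3) ℂ) - η • (vecMulVec ![W 0, W 1, (Real.sqrt (ε + nsq W) : ℂ)] (star ![W 0, W 1, (Real.sqrt (ε + nsq W) : ℂ)]) * J)))
        (∫ W : Fin 2 → ℂ, (2 * Real.sqrt (ε + nsq W))⁻¹ • (fderiv ℝ Θ (u • (1 : Matrix (Fin 3) (Fin 3) ℂ) - η • (vecMulVec ![W 0, W 1, (Real.sqrt (ε + nsq W) : ℂ)] (star ![W 0, W 1, (Real.sqrt (ε + nsq W) : ℂ)]) * J))) (-(η • ((vecMulVec ![W 0, W 1, 0] (star ![(0 : ℂ), 0, 1]) + vecMulVec ![(0 : ℂ), 0, 1] (star ![W 0, W 1, 0])) * J + (2 * Real.sqrt (ε + nsq W)) • (vecMulVec ![(0 : ℂ), 0, 1] (star ![(0 : ℂ), 0, 1]) * J))))) ε := by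
  obtain ⟨S, -, hS⟩ := exists_sq_support_bound_sheet Θ hΘc u hη
  exact hasDerivAt_integral_sheet (Λ := fun (W : Fin 2 → ℂ) (r : ℝ) => Θ (u • (1 : Matrix (Fin 3) (Fin 3) ℂ) - η • (vecMulVec ![W 0, W 1, (r : ℂ)] (star ![W 0, W 1, (r : ℂ)]) * J))) (Λ' := fun (W : Fin 2 → ℂ) (r : ℝ) => (fderiv ℝ Θ (u • (1 : Matrix (Fin 3) (Fin 3) ℂ) - η • (vecMulVec ![W 0, W 1, (r : ℂ)] (star ![W 0, W 1, (r : ℂ)]) * J))) (-(η • ((vecMulVec ![W 0, W 1, 0] (star ![(0 : ℂ), 0, 1]) + vecMulVec ![(0 : ℂ), 0, 1] (star ![W 0, W 1, 0])) * J + (2 * r) • (vecMulVec ![(0 : ℂ), 0, 1] (star ![(0 : ℂ), 0, 1]) * J)))))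
    (hΘ.continuous.comp (continuous_sheet_arg u η))
    ((hΘ.continuous_fderiv_apply hn).comp ((continuous_sheet_arg u η).prodMk (continuous_sheet_dir η)))
    (fun W r => hasDerivAt_comp_sheet_arg Θ hΘ hn u η W r) hS hε

/-- **`I₁` IS DIFFERENTIABLE FOR `ε > 0` WITH `I₁′ = I₂`** for `Θ` of class `C²` (★ `hasDerivAt_integral_sheet_deriv` instantiated; the order-2 integrand is
integrable). [cite: Rogawski1990, §8.4 pp. 126–127] [cite: Rudin1980, §1.4] -/
theorem hasDerivAt_integral_kCentral_sheet_deriv (Θ : Matrix (Fin 3) (Fin 3) ℂ → G) {n : WithTop ℕ∞} (hΘ : ContDiff ℝ n Θ) (hn : 2 ≤ n)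
    (hΘc : HasCompactSupport Θ) (u : ℂ) {η : ℂ} (hη : η ≠ 0) {ε : ℝ} (hε : 0 < ε) :
    Integrable (fun W : Fin 2 → ℂ => (4 * Real.sqrt (ε + nsq W) ^ 2)⁻¹ • ((fderiv ℝ (fderiv ℝ Θ) (u • (1 : Matrix (Fin 3) (Fin 3) ℂ) - η • (vecMulVec ![W 0, W 1, (Real.sqrt (ε + nsq W) : ℂ)] (star ![W 0, W 1, (Real.sqrt (ε + nsq W) : ℂ)]) * J)) (-(η • ((vecMulVec ![W 0, W 1, 0] (star ![(0 : ℂ), 0, 1]) + vecMulVec ![(0 : ℂ), 0, 1] (star ![W 0, W 1, 0])) * J + (2 * Real.sqrt (ε + nsq W)) • (vecMulVec ![(0 : ℂ), 0, 1] (star ![(0 : ℂ), 0, 1]) * J))))) (-(η • ((vecMulVec ![W 0, W 1, 0] (star ![(0 : ℂ), 0, 1]) + vecMulVec ![(0 : ℂ), 0, 1] (star ![W 0, W 1, 0])) * J + (2 * Real.sqrt (ε + nsq W)) • (vecMulVec ![(0 : ℂ), 0, 1] (star ![(0 : ℂ), 0, 1]) * J)))) + (fderiv ℝ Θ (u • (1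 : Matrix (Fin 3) (Fin 3) ℂ) - η • (vecMulVec ![W 0, W 1, (Real.sqrt (ε + nsq W) : ℂ)] (star ![W 0, W 1, (Real.sqrt (ε + nsq W) : ℂ)]) * J))) (-(η • ((2 : ℝ) • (vecMulVec ![(0 : ℂ), 0, 1] (star ![(0 : ℂ), 0, 1]) * J))))) - (4 * Real.sqrt (ε + nsq W) ^ 3)⁻¹ • (fderiv ℝ Θ (u • (1 : Matrix (Fin 3) (Fin 3) ℂ) - η • (vecMulVec ![W 0, W 1, (Real.sqrt (ε + nsq W) : ℂ)] (star ![W 0, W 1, (Real.sqrt (ε + nsq W) : ℂ)]) * J))) (-(η • ((vecMulVec ![W 0, W 1, 0] (star ![(0 : ℂ), 0, 1]) + vecMulVec ![(0 : ℂ), 0, 1] (star ![W 0, W 1, 0])) * J + (2 * Real.sqrt (ε + nsq W)) • (vecMulVec ![(0 : ℂ), 0, 1] (star ![(0 : ℂ), 0, 1]) * J))))) ∧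
      HasDerivAt (fun ε : ℝ => ∫ W : Fin 2 → ℂ, (2 * Real.sqrt (ε + nsq W))⁻¹ • (fderiv ℝ Θ (u • (1 : Matrix (Fin 3) (Fin 3) ℂ) - η • (vecMulVec ![W 0, W 1, (Real.sqrt (ε + nsq W) : ℂ)] (star ![W 0, W 1, (Real.sqrt (ε + nsq W) : ℂ)]) * J))) (-(η • ((vecMulVec ![W 0, W 1, 0] (star ![(0 : ℂ), 0, 1]) + vecMulVec ![(0 : ℂ), 0, 1] (star ![W 0, W 1, 0])) * J + (2 * Real.sqrt (ε + nsq W)) • (vecMulVec ![(0 : ℂ), 0, 1] (star ![(0 : ℂ), 0, 1]) * J)))))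
        (∫ W : Fin 2 → ℂ, (4 * Real.sqrt (ε + nsq W) ^ 2)⁻¹ • ((fderiv ℝ (fderiv ℝ Θ) (u • (1 : Matrix (Fin 3) (Fin 3) ℂ) - η • (vecMulVec ![W 0, W 1, (Real.sqrt (ε + nsq W) : ℂ)] (star ![W 0, W 1, (Real.sqrt (ε + nsq W) : ℂ)]) * J)) (-(η • ((vecMulVec ![W 0, W 1, 0] (star ![(0 : ℂ), 0, 1]) + vecMulVec ![(0 : ℂ), 0, 1] (star ![W 0, W 1, 0])) * J + (2 * Real.sqrt (ε + nsq W)) • (vecMulVec ![(0 : ℂ), 0, 1] (star ![(0 : ℂ), 0, 1]) * J))))) (-(η • ((vecMulVec ![W 0, W 1, 0] (star ![(0 : ℂ), 0, 1]) + vecMulVec ![(0 : ℂ), 0, 1] (star ![W 0, W 1, 0])) * J + (2 * Real.sqrt (ε + nsq W)) • (vecMulVec ![(0 : ℂ), 0, 1] (star ![(0 : ℂ), 0, 1]) * J)))) + (fderiv ℝ Θ (u • (1 : Matrix (Fin 3) (Fin 3) ℂ) - η • (vecMulVec ![W 0, W 1, (Real.sqrt (ε + nsq W) : ℂ)] (star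 ![W 0, W 1, (Real.sqrt (ε + nsq W) : ℂ)]) * J))) (-(η • ((2 : ℝ) • (vecMulVec ![(0 : ℂ), 0, 1] (star ![(0 : ℂ), 0, 1]) * J))))) - (4 * Real.sqrt (ε + nsq W) ^ 3)⁻¹ • (fderiv ℝ Θ (u • (1 : Matrix (Fin 3) (Fin 3) ℂ) - η • (vecMulVec ![W 0, W 1, (Real.sqrt (ε + nsq W) : ℂ)] (star ![W 0, W 1, (Real.sqrt (ε + nsq W) : ℂ)]) * J))) (-(η • ((vecMulVec ![W 0, W 1, 0] (star ![(0 : ℂ), 0, 1]) + vecMulVec ![(0 : ℂ), 0, 1] (star ![W 0, W 1, 0])) * J + (2 * Real.sqrt (ε + nsq W)) • (vecMulVec ![(0 : ℂ), 0, 1] (star ![(0 : ℂ), 0, 1]) * J))))) ε := by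
  have hn0 : n ≠ 0 := by intro h; rw [h] at hn; exact absurd hn (by norm_num)
  obtain ⟨S, -, hS⟩ := exists_sq_support_bound_sheet Θ hΘc u hη
  exact hasDerivAt_integral_sheet_deriv (Λ := fun (W : Fin 2 → ℂ) (r : ℝ) => Θ (u • (1 : Matrix (Fin 3) (Fin 3) ℂ) - η • (vecMulVec ![W 0, W 1, (r : ℂ)] (star ![W 0, W 1, (r : ℂ)]) * J))) (Λ' := fun (W : Fin 2 → ℂ) (r : ℝ) => (fderiv ℝ Θ (u • (1 : Matrix (Fin 3) (Fin 3) ℂ) - η • (vecMulVec ![W 0, W 1, (r : ℂ)] (star ![W 0, W 1, (r : ℂ)]) * J))) (-(η • ((vecMulVec ![W 0, W 1, 0] (star ![(0 : ℂ), 0, 1]) + vecMulVec ![(0 : ℂ), 0, 1] (star ![W 0, W 1, 0])) * J + (2 * r) • (vecMulVec ![(0 : ℂ), 0, 1] (star ![(0 : ℂ), 0, 1]) * J))))) (Λ'' := fun (W : Fin 2 → ℂ) (r : ℝ) => ((fderiv ℝ (fderiv ℝ Θ) (u • (1 : Matrix (Fin 3) (Fin 3) ℂ) - η • (vecMulVec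 ![W 0, W 1, (r : ℂ)] (star ![W 0, W 1, (r : ℂ)]) * J)) (-(η • ((vecMulVec ![W 0, W 1, 0] (star ![(0 : ℂ), 0, 1]) + vecMulVec ![(0 : ℂ), 0, 1] (star ![W 0, W 1, 0])) * J + (2 * r) • (vecMulVec ![(0 : ℂ), 0, 1] (star ![(0 : ℂ), 0, 1]) * J))))) (-(η • ((vecMulVec ![W 0, W 1, 0] (star ![(0 : ℂ), 0, 1]) + vecMulVec ![(0 : ℂ), 0, 1] (star ![W 0, W 1, 0])) * J + (2 * r) • (vecMulVec ![(0 : ℂ), 0, 1] (star ![(0 : ℂ), 0, 1]) * J)))) + (fderiv ℝ Θ (u • (1 : Matrix (Fin 3) (Fin 3) ℂ) - η • (vecMulVec ![W 0, W 1, (r : ℂ)] (star ![W 0, W 1, (r : ℂ)]) * J))) (-(η • ((2 : ℝ) • (vecMulVec ![(0 : ℂ), 0, 1] (star ![(0 : ℂ), 0, 1]) * J))))))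
    (hΘ.continuous.comp (continuous_sheet_arg u η))
    ((hΘ.continuous_fderiv_apply hn0).comp ((continuous_sheet_arg u η).prodMk (continuous_sheet_dir η)))
    (continuous_sheet_datum_two Θ hΘ hn u η)
    (fun W r => hasDerivAt_comp_sheet_arg Θ hΘ hn0 u η W r) (fun W r => hasDerivAt_fderiv_comp_sheet_arg Θ hΘ hn u η W r) hS hε

/-- **`I_Θ` IS CONTINUOUS ON `[0, ∞)`** (down to the cone). [cite: Rogawski1990, §8.4 pp. 126–127] [cite: Rudin1980, §1.4] -/
theorem continuousOn_integral_kCentral_sheet_zero (Θ : Matrix (Fin 3) (Fin 3) ℂ → G) (hΘ : Continuous Θ) (hΘc : HasCompactSupport Θ) (u : ℂ)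
    {η : ℂ} (hη : η ≠ 0) :
    ContinuousOn (fun ε : ℝ => ∫ W : Fin 2 → ℂ, Θ (u • (1 : Matrix (Fin 3) (Fin 3) ℂ) - η • (vecMulVec ![W 0, W 1, (Real.sqrt (ε + nsq W) : ℂ)] (star ![W 0, W 1, (Real.sqrt (ε + nsq W) : ℂ)]) * J))) (Ici 0) := by
  obtain ⟨S, -, hS⟩ := exists_sq_support_bound_sheet Θ hΘc u hη
  exact continuousOn_integral_sheet_zero (Λ := fun (W : Fin 2 → ℂ) (r : ℝ) => Θ (u • (1 : Matrix (Fin 3) (Fin 3) ℂ) - η • (vecMulVec ![W 0, W 1, (r : ℂ)] (star ![W 0, W 1, (r : ℂ)]) * J))) (hΘ.comp (continuous_sheet_arg u η)) hS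

/-- **`I₁` IS CONTINUOUS ON `[0, ∞)`** for `Θ` of class `C¹`. [cite: Rogawski1990, §8.4 pp. 126–127] [cite: Rudin1980, §1.4] -/
theorem continuousOn_integral_kCentral_sheet_one (Θ : Matrix (Fin 3) (Fin 3) ℂ → G) {n : WithTop ℕ∞} (hΘ : ContDiff ℝ n Θ) (hn : n ≠ 0)
    (hΘc : HasCompactSupport Θ) (u : ℂ) {η : ℂ} (hη : η ≠ 0) :
    ContinuousOn (fun ε : ℝ => ∫ W : Fin 2 → ℂ, (2 * Real.sqrt (ε + nsq W))⁻¹ • (fderiv ℝ Θ (u • (1 : Matrix (Fin 3) (Fin 3) ℂ) - η • (vecMulVec ![W 0, W 1, (Real.sqrt (ε + nsq W) : ℂ)] (star ![W 0, W 1, (Real.sqrt (ε + nsq W) : ℂ)]) * J))) (-(η • ((vecMulVec ![W 0, W 1, 0] (star ![(0 : ℂ), 0, 1]) + vecMulVec ![(0 : ℂ), 0, 1] (star ![W 0, W 1, 0])) * J + (2 * Real.sqrt (ε + nsq W)) • (vecMulVec ![(0 : ℂ), 0, 1] (star ![(0 : ℂ), 0, 1]) * J))))) (Ici 0) := by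
  obtain ⟨S, -, hS⟩ := exists_sq_support_bound_sheet Θ hΘc u hη
  exact continuousOn_integral_sheet_one (Λ := fun (W : Fin 2 → ℂ) (r : ℝ) => Θ (u • (1 : Matrix (Fin 3) (Fin 3) ℂ) - η • (vecMulVec ![W 0, W 1, (r : ℂ)] (star ![W 0, W 1, (r : ℂ)]) * J))) (Λ' := fun (W : Fin 2 → ℂ) (r : ℝ) => (fderiv ℝ Θ (u • (1 : Matrix (Fin 3) (Fin 3) ℂ) - η • (vecMulVec ![W 0, W 1, (r : ℂ)] (star ![W 0, W 1, (r : ℂ)]) * J))) (-(η • ((vecMulVec ![W 0, W 1, 0] (star ![(0 : ℂ), 0, 1]) + vecMulVec ![(0 : ℂ), 0, 1] (star ![W 0, W 1, 0])) * J + (2 * r) • (vecMulVec ![(0 : ℂ), 0, 1] (star ![(0 : ℂ), 0, 1]) * J)))))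
    ((hΘ.continuous_fderiv_apply hn).comp ((continuous_sheet_arg u η).prodMk (continuous_sheet_dir η)))
    (fun W r => hasDerivAt_comp_sheet_arg Θ hΘ hn u η W r) hS

/-- **`I₂` IS CONTINUOUS ON `[0, ∞)`** for `Θ` of class `C²`. [cite: Rogawski1990, §8.4 pp. 126–127] [cite: Rudin1980, §1.4] -/
theorem continuousOn_integral_kCentral_sheet_two (Θ : Matrix (Fin 3) (Fin 3) ℂ → G) {n : WithTop ℕ∞} (hΘ : ContDiff ℝ n Θ) (hn : 2 ≤ n)
    (hΘc : HasCompactSupport Θ) (u : ℂ) {η : ℂ} (hη : η ≠ 0) :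
    ContinuousOn (fun ε : ℝ => ∫ W : Fin 2 → ℂ, (4 * Real.sqrt (ε + nsq W) ^ 2)⁻¹ • ((fderiv ℝ (fderiv ℝ Θ) (u • (1 : Matrix (Fin 3) (Fin 3) ℂ) - η • (vecMulVec ![W 0, W 1, (Real.sqrt (ε + nsq W) : ℂ)] (star ![W 0, W 1, (Real.sqrt (ε + nsq W) : ℂ)]) * J)) (-(η • ((vecMulVec ![W 0, W 1, 0] (star ![(0 : ℂ), 0, 1]) + vecMulVec ![(0 : ℂ), 0, 1] (star ![W 0, W 1, 0])) * J + (2 * Real.sqrt (ε + nsq W)) • (vecMulVec ![(0 : ℂ), 0, 1] (star ![(0 : ℂ), 0, 1]) * J))))) (-(η • ((vecMulVec ![W 0, W 1, 0] (star ![(0 : ℂ), 0, 1]) + vecMulVec ![(0 : ℂ), 0, 1] (star ![W 0, W 1, 0])) * J + (2 * Real.sqrt (ε + nsq W)) • (vecMulVec ![(0 : ℂ), 0, 1] (star ![(0 : ℂ), 0, 1]) * J)))) + (fderiv ℝ Θ (u • (1 : Matrix (Fin 3) (Fin 3) ℂ) - η • (vecMulVec ![W 0, W 1, (Real.sqrt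 (ε + nsq W) : ℂ)] (star ![W 0, W 1, (Real.sqrt (ε + nsq W) : ℂ)]) * J))) (-(η • ((2 : ℝ) • (vecMulVec ![(0 : ℂ), 0, 1] (star ![(0 : ℂ), 0, 1]) * J))))) - (4 * Real.sqrt (ε + nsq W) ^ 3)⁻¹ • (fderiv ℝ Θ (u • (1 : Matrix (Fin 3) (Fin 3) ℂ) - η • (vecMulVec ![W 0, W 1, (Real.sqrt (ε + nsq W) : ℂ)] (star ![W 0, W 1, (Real.sqrt (ε + nsq W) : ℂ)]) * J))) (-(η • ((vecMulVec ![W 0, W 1, 0] (star ![(0 : ℂ), 0, 1]) + vecMulVec ![(0 : ℂ), 0, 1] (star ![W 0, W 1, 0])) * J + (2 * Real.sqrt (ε + nsq W)) • (vecMulVec ![(0 : ℂ), 0, 1] (star ![(0 : ℂ), 0, 1]) * J))))) (Ici 0) := by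
  have hn0 : n ≠ 0 := by intro h; rw [h] at hn; exact absurd hn (by norm_num)
  obtain ⟨S, -, hS⟩ := exists_sq_support_bound_sheet Θ hΘc u hη
  exact continuousOn_integral_sheet_two (Λ := fun (W : Fin 2 → ℂ) (r : ℝ) => Θ (u • (1 : Matrix (Fin 3) (Fin 3) ℂ) - η • (vecMulVec ![W 0, W 1, (r : ℂ)] (star ![W 0, W 1, (r : ℂ)]) * J))) (Λ' := fun (W : Fin 2 → ℂ) (r : ℝ) => (fderiv ℝ Θ (u • (1 : Matrix (Fin 3) (Fin 3) ℂ) - η • (vecMulVec ![W 0, W 1, (r : ℂ)] (star ![W 0, W 1, (r : ℂ)]) * J))) (-(η • ((vecMulVec ![W 0, W 1, 0] (star ![(0 : ℂ), 0, 1]) + vecMulVec ![(0 : ℂ), 0, 1] (star ![W 0, W 1, 0])) * J + (2 * r) • (vecMulVec ![(0 : ℂ), 0, 1] (star ![(0 : ℂ), 0, 1]) * J))))) (Λ'' := fun (W : Fin 2 → ℂ) (r : ℝ) => ((fderiv ℝ (fderiv ℝ Θ) (u • (1 : Matrix (Fin 3) (Fin 3) ℂ) - η • (vecMulVec ![W 0,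 W 1, (r : ℂ)] (star ![W 0, W 1, (r : ℂ)]) * J)) (-(η • ((vecMulVec ![W 0, W 1, 0] (star ![(0 : ℂ), 0, 1]) + vecMulVec ![(0 : ℂ), 0, 1] (star ![W 0, W 1, 0])) * J + (2 * r) • (vecMulVec ![(0 : ℂ), 0, 1] (star ![(0 : ℂ), 0, 1]) * J))))) (-(η • ((vecMulVec ![W 0, W 1, 0] (star ![(0 : ℂ), 0, 1]) + vecMulVec ![(0 : ℂ), 0, 1] (star ![W 0, W 1, 0])) * J + (2 * r) • (vecMulVec ![(0 : ℂ), 0, 1] (star ![(0 : ℂ), 0, 1]) * J)))) + (fderiv ℝ Θ (u • (1 : Matrix (Fin 3) (Fin 3) ℂ) - η • (vecMulVec ![W 0, W 1, (r : ℂ)] (star ![W 0, W 1, (r : ℂ)]) * J))) (-(η • ((2 : ℝ) • (vecMulVec ![(0 : ℂ), 0, 1] (star ![(0 : ℂ), 0, 1]) * J))))))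
    ((hΘ.continuous_fderiv_apply hn0).comp ((continuous_sheet_arg u η).prodMk (continuous_sheet_dir η)))
    (continuous_sheet_datum_two Θ hΘ hn u η)
    (fun W r => hasDerivAt_comp_sheet_arg Θ hΘ hn0 u η W r) (fun W r => hasDerivAt_fderiv_comp_sheet_arg Θ hΘ hn u η W r) hS

/-- **ONE-SIDED FIRST DERIVATIVE AT THE CENTRE**: `I_Θ` has right-derivative `I₁(0) = ∫ (2|W|)⁻¹•DΘ(u•1 − η•N(W,|W|))[v(W,|W|)] d⁴W` at `ε = 0`
(an absolutely convergent integral over the NULL CONE). [cite: Rogawski1990, §8.4 pp. 126–127] [cite: Rudin1980, §1.4] -/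
theorem hasDerivWithinAt_integral_kCentral_sheet_zero (Θ : Matrix (Fin 3) (Fin 3) ℂ → G) {n : WithTop ℕ∞} (hΘ : ContDiff ℝ n Θ) (hn : n ≠ 0)
    (hΘc : HasCompactSupport Θ) (u : ℂ) {η : ℂ} (hη : η ≠ 0) :
    HasDerivWithinAt (fun ε : ℝ => ∫ W : Fin 2 → ℂ, Θ (u • (1 : Matrix (Fin 3) (Fin 3) ℂ) - η • (vecMulVec ![W 0, W 1, (Real.sqrt (ε + nsq W) : ℂ)] (star ![W 0, W 1, (Real.sqrt (ε + nsq W) : ℂ)]) * J)))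
      (∫ W : Fin 2 → ℂ, (2 * Real.sqrt (nsq W))⁻¹ • (fderiv ℝ Θ (u • (1 : Matrix (Fin 3) (Fin 3) ℂ) - η • (vecMulVec ![W 0, W 1, (Real.sqrt (nsq W) : ℂ)] (star ![W 0, W 1, (Real.sqrt (nsq W) : ℂ)]) * J))) (-(η • ((vecMulVec ![W 0, W 1, 0] (star ![(0 : ℂ), 0, 1]) + vecMulVec ![(0 : ℂ), 0, 1] (star ![W 0, W 1, 0])) * J + (2 * Real.sqrt (nsq W)) • (vecMulVec ![(0 : ℂ), 0, 1] (star ![(0 : ℂ), 0, 1]) * J))))) (Ici 0) 0 := by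
  obtain ⟨S, -, hS⟩ := exists_sq_support_bound_sheet Θ hΘc u hη
  exact hasDerivWithinAt_integral_sheet_zero (Λ := fun (W : Fin 2 → ℂ) (r : ℝ) => Θ (u • (1 : Matrix (Fin 3) (Fin 3) ℂ) - η • (vecMulVec ![W 0, W 1, (r : ℂ)] (star ![W 0, W 1, (r : ℂ)]) * J))) (Λ' := fun (W : Fin 2 → ℂ) (r : ℝ) => (fderiv ℝ Θ (u • (1 : Matrix (Fin 3) (Fin 3) ℂ) - η • (vecMulVec ![W 0, W 1, (r : ℂ)] (star ![W 0, W 1, (r : ℂ)]) * J))) (-(η • ((vecMulVec ![W 0, W 1, 0] (star ![(0 : ℂ), 0, 1]) + vecMulVec ![(0 : ℂ), 0, 1] (star ![W 0, W 1, 0])) * J + (2 * r) • (vecMulVec ![(0 : ℂ), 0, 1] (star ![(0 : ℂ), 0, 1]) * J)))))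
    (hΘ.continuous.comp (continuous_sheet_arg u η))
    ((hΘ.continuous_fderiv_apply hn).comp ((continuous_sheet_arg u η).prodMk (continuous_sheet_dir η)))
    (fun W r => hasDerivAt_comp_sheet_arg Θ hΘ hn u η W r) hS

/-- **ONE-SIDED SECOND DERIVATIVE AT THE CENTRE**: `I₁` has right-derivative `I₂(0)` at `ε = 0` for `Θ` of class `C²` with compact support; hence
`ε²·Φ(k_ε, Θ) = 9[I_Θ(0) + I₁(0)ε + ½I₂(0)ε²] + o(ε²)` — the second-order expansion of the normalised `K`-central orbital integrals of `U(2,1)` at the centre,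
with all three coefficients absolutely convergent integrals over the null cone. [cite: Rogawski1990, §8.4 pp. 126–127] [cite: Rudin1980, §1.4] -/
theorem hasDerivWithinAt_integral_kCentral_sheet_one (Θ : Matrix (Fin 3) (Fin 3) ℂ → G) {n : WithTop ℕ∞} (hΘ : ContDiff ℝ n Θ) (hn : 2 ≤ n)
    (hΘc : HasCompactSupport Θ) (u : ℂ) {η : ℂ} (hη : η ≠ 0) :
    HasDerivWithinAt (fun ε : ℝ => ∫ W : Fin 2 → ℂ, (2 * Real.sqrt (ε + nsq W))⁻¹ • (fderiv ℝ Θ (u • (1 : Matrix (Fin 3) (Fin 3) ℂ) - η • (vecMulVec ![W 0, W 1, (Real.sqrt (ε + nsq W) : ℂ)] (star ![W 0, W 1, (Real.sqrt (ε + nsq W) : ℂ)]) * J))) (-(η • ((vecMulVec ![W 0, W 1, 0] (star ![(0 : ℂ), 0, 1]) + vecMulVec ![(0 : ℂ), 0, 1] (star ![W 0, W 1, 0])) * J + (2 * Real.sqrt (ε + nsq W)) • (vecMulVec ![(0 : ℂ), 0, 1] (star ![(0 : ℂ), 0, 1]) * J)))))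
      (∫ W : Fin 2 → ℂ, (4 * Real.sqrt (nsq W) ^ 2)⁻¹ • ((fderiv ℝ (fderiv ℝ Θ) (u • (1 : Matrix (Fin 3) (Fin 3) ℂ) - η • (vecMulVec ![W 0, W 1, (Real.sqrt (nsq W) : ℂ)] (star ![W 0, W 1, (Real.sqrt (nsq W) : ℂ)]) * J)) (-(η • ((vecMulVec ![W 0, W 1, 0] (star ![(0 : ℂ), 0, 1]) + vecMulVec ![(0 : ℂ), 0, 1] (star ![W 0, W 1, 0])) * J + (2 * Real.sqrt (nsq W)) • (vecMulVec ![(0 : ℂ), 0, 1] (star ![(0 : ℂ), 0, 1]) * J))))) (-(η • ((vecMulVec ![W 0, W 1, 0] (star ![(0 : ℂ), 0, 1]) + vecMulVec ![(0 : ℂ), 0, 1] (star ![W 0, W 1, 0])) * J + (2 * Real.sqrt (nsq W)) • (vecMulVec ![(0 : ℂ), 0, 1] (star ![(0 : ℂ), 0, 1]) * J)))) + (fderiv ℝ Θ (u • (1 : Matrix (Fin 3) (Fin 3) ℂ) - η • (vecMulVec ![W 0, W 1, (Real.sqrt (nsq W) : ℂ)] (star ![W 0, W 1, (Real.sqrt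 (nsq W) : ℂ)]) * J))) (-(η • ((2 : ℝ) • (vecMulVec ![(0 : ℂ), 0, 1] (star ![(0 : ℂ), 0, 1]) * J))))) - (4 * Real.sqrt (nsq W) ^ 3)⁻¹ • (fderiv ℝ Θ (u • (1 : Matrix (Fin 3) (Fin 3) ℂ) - η • (vecMulVec ![W 0, W 1, (Real.sqrt (nsq W) : ℂ)] (star ![W 0, W 1, (Real.sqrt (nsq W) : ℂ)]) * J))) (-(η • ((vecMulVec ![W 0, W 1, 0] (star ![(0 : ℂ), 0, 1]) + vecMulVec ![(0 : ℂ), 0, 1] (star ![W 0, W 1, 0])) * J + (2 * Real.sqrt (nsq W)) • (vecMulVec ![(0 : ℂ), 0, 1] (star ![(0 : ℂ), 0, 1]) * J))))) (Ici 0) 0 := by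
  have hn0 : n ≠ 0 := by intro h; rw [h] at hn; exact absurd hn (by norm_num)
  obtain ⟨S, -, hS⟩ := exists_sq_support_bound_sheet Θ hΘc u hη
  exact hasDerivWithinAt_integral_sheet_one (Λ := fun (W : Fin 2 → ℂ) (r : ℝ) => Θ (u • (1 : Matrix (Fin 3) (Fin 3) ℂ) - η • (vecMulVec ![W 0, W 1, (r : ℂ)] (star ![W 0, W 1, (r : ℂ)]) * J))) (Λ' := fun (W : Fin 2 → ℂ) (r : ℝ) => (fderiv ℝ Θ (u • (1 : Matrix (Fin 3) (Fin 3) ℂ) - η • (vecMulVec ![W 0, W 1, (r : ℂ)] (star ![W 0, W 1, (r : ℂ)]) * J))) (-(η • ((vecMulVec ![W 0, W 1, 0] (star ![(0 : ℂ), 0, 1]) + vecMulVec ![(0 : ℂ), 0, 1] (star ![W 0, W 1, 0])) * J + (2 * r) • (vecMulVec ![(0 : ℂ), 0, 1] (star ![(0 : ℂ), 0, 1]) * J))))) (Λ'' := fun (W : Fin 2 → ℂ) (r : ℝ) => ((fderiv ℝ (fderiv ℝ Θ) (u • (1 : Matrix (Fin 3) (Fin 3) ℂ) - η • (vecMulVec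 ![W 0, W 1, (r : ℂ)] (star ![W 0, W 1, (r : ℂ)]) * J)) (-(η • ((vecMulVec ![W 0, W 1, 0] (star ![(0 : ℂ), 0, 1]) + vecMulVec ![(0 : ℂ), 0, 1] (star ![W 0, W 1, 0])) * J + (2 * r) • (vecMulVec ![(0 : ℂ), 0, 1] (star ![(0 : ℂ), 0, 1]) * J))))) (-(η • ((vecMulVec ![W 0, W 1, 0] (star ![(0 : ℂ), 0, 1]) + vecMulVec ![(0 : ℂ), 0, 1] (star ![W 0, W 1, 0])) * J + (2 * r) • (vecMulVec ![(0 : ℂ), 0, 1] (star ![(0 : ℂ), 0, 1]) * J)))) + (fderiv ℝ Θ (u • (1 : Matrix (Fin 3) (Fin 3) ℂ) - η • (vecMulVec ![W 0, W 1, (r : ℂ)] (star ![W 0, W 1, (r : ℂ)]) * J))) (-(η • ((2 : ℝ) • (vecMulVec ![(0 : ℂ), 0, 1] (star ![(0 : ℂ), 0, 1]) * J))))))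
    (hΘ.continuous.comp (continuous_sheet_arg u η))
    ((hΘ.continuous_fderiv_apply hn0).comp ((continuous_sheet_arg u η).prodMk (continuous_sheet_dir η)))
    (continuous_sheet_datum_two Θ hΘ hn u η)
    (fun W r => hasDerivAt_comp_sheet_arg Θ hΘ hn0 u η W r) (fun W r => hasDerivAt_fderiv_comp_sheet_arg Θ hΘ hn u η W r) hS

/-- **THE NORMALISED `K`-CENTRAL ORBITAL INTEGRAL IS `C¹` ON `(0, ∞)` WITH DERIVATIVE `9·I₁`**: for `Θ` of class `C¹` with compact support, `η ≠ 0`, `ε > 0`,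
`d∕dε [ε² · ∫_{𝔹²} Θ(u•1 + (εη)•P(lift z)) dβ] = 9 · I₁(ε)` (★ `sq_smul_integral_bergmanVolume_pencil_eq_chart` near `ε`, then `I_Θ′ = I₁`).
[cite: Rogawski1990, §8.4 pp. 126–127] [cite: Rudin1980, §2.2] -/
theorem hasDerivAt_sq_smul_integral_bergmanVolume_pencil (Θ : Matrix (Fin 3) (Fin 3) ℂ → G) {n : WithTop ℕ∞} (hΘ : ContDiff ℝ n Θ) (hn : n ≠ 0)
    (hΘc : HasCompactSupport Θ) (u : ℂ) {η : ℂ} (hη : η ≠ 0) {ε : ℝ} (hε : 0 < ε) :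
    HasDerivAt (fun ε : ℝ => ε ^ 2 • (∫ z, Θ (u • (1 : Matrix (Fin 3) (Fin 3) ℂ) + ((ε : ℂ) * η) •
        ((((Q (lift z) : ℝ) : ℂ))⁻¹ • (vecMulVec (lift z) (star (lift z)) * J))) ∂bergmanVolume))
      ((9 : ℝ) • ∫ W : Fin 2 → ℂ, (2 * Real.sqrt (ε + nsq W))⁻¹ • (fderiv ℝ Θ (u • (1 : Matrix (Fin 3) (Fin 3) ℂ) - η • (vecMulVec ![W 0, W 1, (Real.sqrt (ε + nsq W) : ℂ)] (star ![W 0, W 1, (Real.sqrt (ε + nsq W) : ℂ)]) * J))) (-(η • ((vecMulVec ![W 0, W 1, 0] (star ![(0 : ℂ), 0, 1]) + vecMulVec ![(0 : ℂ), 0, 1] (star ![W 0, W 1, 0])) * J + (2 * Real.sqrt (ε + nsq W)) • (vecMulVec ![(0 : ℂ), 0, 1] (star ![(0 : ℂ), 0, 1]) * J))))) ε := by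
  have h := ((hasDerivAt_integral_kCentral_sheet Θ hΘ hn hΘc u hη hε).2).const_smul (9 : ℝ)
  refine h.congr_of_eventuallyEq ?_
  filter_upwards [Ioi_mem_nhds hε] with x hx
  exact sq_smul_integral_bergmanVolume_pencil_eq_chart Θ u η hx

end SecondOrder

end Literature.Geometry.ComplexHyperbolic.BallModel

end
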